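import Summits.CriticalPhenomena.PercolationContinuityZ3.Theorems.PercNearOneGluingNoHeavyLowerTailCertRowsGroupData
import Summits.CriticalPhenomena.PercolationContinuityZ3.Theorems.PercNearOneGluingNoHeavyLowerTailCertRowsSHKk
import HarnessLib

/-!
# `NoHeavyLowerTail` (stmt-CriticalPhenomena-4575) — certificate rows: SOUNDNESS of the k-petal sunflower groups (`SFKSpec`)

Support file (prover prim-ineq-prove-1, new-inequality factory; `--supports stmt-CriticalPhenomena-4575`).  No definitions beyond the
bookkeeping `pairSumL`, no named facts, no sorries.  For a valid `SFKSpec` (top test `φA` and all `φA ∨ φ_i` monotone, petals pairwise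
pattern-disjoint and disjoint from `φA`), the row group `SFKSpec.rows` (`…CertRowsGroupData`) satisfies the SUMMED row inequality at the
cell law of every weighted graph and placement: `w·m·Σ_{i<j} c_i c_j ≤ w·m·μ(A)μ(B)`, from the tree's k-petal pattern sunflower
`PatternSunflower.patternSunflower` ([Gladkov2024StrongFKG, Thm. 2.1]) and `2 Σ_{i<j} c_i c_j = (Σ c)² − Σ c²`.
(The group shape follows prim-gen-kcluster's `shkRowsK`; this file makes the factory's quadratic checker independent of it.)
* `pairSumL`, `two_mul_pairSumL`, `linEval_flatten'`, `rowSum_sfkTail`, `rowSum_sfkRows_le`;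
* `patEvent_anyTestL`; **`SFKSpec.rowSum`**, `SFKSpec.rowSum_all`; `sfkSound` (every valid spec `GroupHolds`, the form consumed by `…CondCertCore`).
[cite: Gladkov2024StrongFKG, Thm. 2.1]
-/

noncomputable section

namespace Summit.CriticalPhenomena.PercolationContinuityZ3.Theorems

open MeasureTheory Set Literature.Probability.Percolation
open Literature.Probability.LatticeModels (prodBernoulli)
open scoped Classical BigOperators
open PatternCells CertCheck CertCells PatternSunflower

namespace CertCells

variable {n : ℕ}

/-- `Σ_{i<j} c_i c_j` of a list. [folklore] -/
def pairSumL : List ℝ → ℝ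
  | [] => 0
  | c :: cs => c * cs.sum + pairSumL cs

/-- `2 Σ_{i<j} c_i c_j = (Σ_i c_i)² − Σ_i c_i²`. [folklore] -/
theorem two_mul_pairSumL (cs : List ℝ) : 2 * pairSumL cs = cs.sum ^ 2 - (cs.map fun c => c ^ 2).sum := by
  induction cs with
  | nil => simp [pairSumL]
  | cons c cs ih =>
    simp only [pairSumL, List.sum_cons, List.map_cons]
    nlinarith [ih]

/-- `linEval` of a flattened list of cell lists is the sum of the `linEval`s. [folklore] -/
theorem linEval_flatten' (x : ℕ → ℝ) (L : List (List ℕ)) : linEval x L.flatten = (L.map (linEval x)).sum := by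
  induction L with
  | nil => simp [linEval]
  | cons C rest ih =>
    rw [List.flatten_cons, List.map_cons, List.sum_cons, ← ih]
    simp [linEval, List.map_append, List.sum_append]

/-- The two row sums of the tail group: `w·m·pairSumL` and `0`. [folklore] -/
theorem rowSum_sfkTail (x : ℕ → ℝ) (Cs : List (List ℕ)) (mult : List ℕ) (wt : ℕ) :
    ((sfkTail Cs mult wt).map fun r => (r.wt : ℝ) * evalM x r.mult * (linEval x r.e1 * linEval x r.e2)).sum =
        (wt : ℝ) * evalM x mult * pairSumL (Cs.map (linEval x)) ∧
      ((sfkTail Cs mult wt).map fun r => (r.wt : ℝ) * evalM x r.mult * (linEval x r.e3 * linEval x r.e4)).sum = 0 := by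
  induction Cs with
  | nil => simp [sfkTail, pairSumL]
  | cons C rest ih =>
    obtain ⟨ih1, ih2⟩ := ih
    have h0 : linEval x ([] : List ℕ) = 0 := by simp [linEval]
    refine ⟨?_, ?_⟩
    · simp only [sfkTail, List.map_cons, List.sum_cons, ih1, linEval_flatten', pairSumL]
      ring
    · simp only [sfkTail, List.map_cons, List.sum_cons, ih2, h0]
      ring

/-- The summed inequality of an `sfkRows` group follows from `Σ_{i<j} c_i c_j ≤ μA · μB`. [folklore] -/
theorem rowSum_sfkRows_le (x : ℕ → ℝ) (hx : ∀ i, 0 ≤ x i) (A B : List ℕ) (Cs : List (List ℕ)) (mult : List ℕ) (wt : ℕ)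
    (hshk : pairSumL (Cs.map (linEval x)) ≤ linEval x A * linEval x B) :
    ((sfkRows A B Cs mult wt).map fun r => (r.wt : ℝ) * evalM x r.mult * (linEval x r.e1 * linEval x r.e2)).sum ≤
      ((sfkRows A B Cs mult wt).map fun r => (r.wt : ℝ) * evalM x r.mult * (linEval x r.e3 * linEval x r.e4)).sum := by
  cases Cs with
  | nil => simp [sfkRows]
  | cons C rest =>
    obtain ⟨t1, t2⟩ := rowSum_sfkTail x rest mult wt
    simp only [sfkRows, List.map_cons, List.sum_cons, t1, t2, linEval_flatten']
    simp only [List.map_cons, pairSumL] at hshk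
    have hw : 0 ≤ (wt : ℝ) * evalM x mult := mul_nonneg (Nat.cast_nonneg _) (evalM_nonneg x hx _)
    nlinarith [mul_le_mul_of_nonneg_left hshk hw]

/-- The pattern event of the disjunction of a list of tests is the union over the list. [folklore] -/
theorem patEvent_anyTestL (v : Fin 5 → Fin n) (φs : List (ℕ → Bool)) :
    PatEvent v (anyTestL φs) = ⋃ i : Fin φs.length, PatEvent v (φs.get i) := by
  ext ω
  obtain ⟨m, hm, hcell⟩ := exists_mem_cell v ω
  simp only [Set.mem_iUnion, mem_patEvent_iff v _ hm hcell, anyTestL, List.any_eq_true]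
  constructor
  · rintro ⟨φ, hφ, h⟩
    obtain ⟨i, rfl⟩ := List.mem_iff_get.1 hφ
    exact ⟨i, h⟩
  · rintro ⟨i, h⟩
    exact ⟨φs.get i, List.get_mem φs i, h⟩

/-- **A valid k-petal sunflower spec yields rows valid IN SUM at every cell law.** [cite: Gladkov2024StrongFKG, Thm. 2.1] -/
theorem SFKSpec.rowSum (s : SFKSpec) (hs : s.valid = true) (w : Sym2 (Fin n) → unitInterval) (v : Fin 5 → Fin n) :
    let x : ℕ → ℝ := fun m => (prodBernoulli w).real (Cell v m)
    (s.rows.map fun r => (r.wt : ℝ) * evalM x r.mult * (linEval x r.e1 * linEval x r.e2)).sum ≤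
      (s.rows.map fun r => (r.wt : ℝ) * evalM x r.mult * (linEval x r.e3 * linEval x r.e4)).sum := by
  intro x
  have hx : ∀ i, 0 ≤ x i := fun _ => measureReal_nonneg
  simp only [SFKSpec.valid, Bool.and_eq_true, List.all_eq_true] at hs
  obtain ⟨⟨⟨hA, hAC⟩, hdisjB⟩, hdisjA⟩ := hs
  have hdisj := pairwise_of_allPairs _ _ hdisjB
  apply rowSum_sfkRows_le x hx
  set k := s.φCs.length with hk
  have hsf := patternSunflower w v (Finset.univ : Finset (Fin k)) s.φA (fun i => s.φCs.get i) hA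
    (fun i _ => hAC _ (List.get_mem s.φCs i))
    (fun i _ j _ hij => by
      have hne : (i : ℕ) ≠ j := fun h => hij (Fin.ext h)
      rcases Nat.lt_or_gt_of_ne hne with hlt | hgt
      · exact List.Pairwise.rel_get_of_lt hdisj hlt
      · have h := List.Pairwise.rel_get_of_lt hdisj hgt
        unfold DisjPat at h ⊢
        rw [List.all_eq_true] at h ⊢
        intro m hm
        have := h m hm
        simp only [Bool.not_and, Bool.or_eq_true, Bool.not_eq_true'] at this ⊢
        tauto)
    (fun i _ => hdisjA _ (List.get_mem s.φCs i))
  have hmap : (s.φCs.map patCells).map (linEval x) = List.ofFn fun i : Fin k => (prodBernoulli w).real (PatEvent v (s.φCs.get i)) := by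
    apply List.ext_get
    · simp [hk]
    · intro i h1 h2
      simp only [List.get_eq_getElem, List.getElem_map, List.getElem_ofFn]
      exact linEval_patCells _ v _
  have hsum : (List.ofFn fun i : Fin k => (prodBernoulli w).real (PatEvent v (s.φCs.get i))).sum =
      ∑ i : Fin k, (prodBernoulli w).real (PatEvent v (s.φCs.get i)) := by
    rw [List.sum_ofFn]
  have hsq : ((List.ofFn fun i : Fin k => (prodBernoulli w).real (PatEvent v (s.φCs.get i))).map fun c => c ^ 2).sum =
      ∑ i : Fin k, (prodBernoulli w).real (PatEvent v (s.φCs.get i)) ^ 2 := by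
    rw [List.map_ofFn, List.sum_ofFn]; rfl
  have hB : (prodBernoulli w).real (PatEvent v s.φB) =
      (prodBernoulli w).real (PatEvent v s.φA ∪ ⋃ i : Fin k, PatEvent v (s.φCs.get i))ᶜ := by
    have e : s.φB = fun m => !((fun m' => s.φA m' || anyTestL s.φCs m') m) := rfl
    rw [e, patEvent_not, PatternSunflower.patEvent_or, patEvent_anyTestL]
  simp only [Finset.mem_univ, Set.iUnion_true] at hsf
  rw [linEval_patCells, linEval_patCells, hmap, hB]
  have h2 := two_mul_pairSumL (List.ofFn fun i : Fin k => (prodBernoulli w).real (PatEvent v (s.φCs.get i)))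
  rw [hsum, hsq] at h2
  linarith

/-- Rows valid in sum over a list of k-petal sunflower specs. [folklore] -/
theorem SFKSpec.rowSum_all (specs : List SFKSpec) (hvalid : specs.all SFKSpec.valid = true) (w : Sym2 (Fin n) → unitInterval)
    (v : Fin 5 → Fin n) :
    let x : ℕ → ℝ := fun m => (prodBernoulli w).real (Cell v m)
    ((specs.flatMap SFKSpec.rows).map fun r => (r.wt : ℝ) * evalM x r.mult * (linEval x r.e1 * linEval x r.e2)).sum ≤
      ((specs.flatMap SFKSpec.rows).map fun r => (r.wt : ℝ) * evalM x r.mult * (linEval x r.e3 * linEval x r.e4)).sum := by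
  intro x
  induction specs with
  | nil => simp
  | cons s rest ih =>
    simp only [List.all_cons, Bool.and_eq_true] at hvalid
    rw [List.flatMap_cons, List.map_append, List.map_append, List.sum_append, List.sum_append]
    exact add_le_add (SFKSpec.rowSum s hvalid.1 w v) (ih hvalid.2)

/-- **The k-petal sunflower groups are sound.** [cite: Gladkov2024StrongFKG, Thm. 2.1] -/
theorem sfkSound : ∀ s : SFKSpec, s.valid = true → GroupHolds s.rows := fun s hs _ w v => SFKSpec.rowSum s hs w v

end CertCells

end Summit.CriticalPhenomena.PercolationContinuityZ3.Theorems

end
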